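import Mathlib.Topology.Maps.Proper.Basic
import HarnessLib

/-!
# Pull-backs of proper maps; descent of maps and homeomorphisms along proper surjections

Topic `Literature/Topology`; theorems only. For `p : B' → B` PROPER and `π : E → B` continuous,
the projection of the fibre product `E ×_B B' = {(e, b') | π e = p b'} → E` is proper
(`isProperMap_pullback_fst`: closed by the universal closedness of `p`, fibres = fibres of `p`),
hence a quotient map when `p` is moreover surjective (`isQuotientMap_pullback_fst`). Consequently
(«proper surjections are descent morphisms for spaces over `B`», morphism level):

* `existsUnique_factor`, `continuous_of_comp_pullback_fst` — a continuous map
  `E ×_B B' → T` constant on the fibres over `E` factors uniquely through a continuous `E → T`;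
* `exists_homeomorph_descent` — a homeomorphism `E ×_B B' ≃ₜ T ×_B B'` over `B'`, compatible
  (together with its inverse) with the canonical descent data, descends to a homeomorphism
  `E ≃ₜ T` over `B`.

(Bourbaki, *Topologie générale*, I §10 no. 1 Prop. 5 (proper maps are universally closed, stable
under base change) and I §3 (quotients); descent: Grothendieck, SGA 1 Exp. IX/XII.) Intended use:
the last, topological, step of the descent of Riemann's existence theorem along the
normalisation `S̃ → S` (SGA 1 XII 5.1, proof, part 2 a)), where `S̃(ℂ) → S(ℂ)` is proper
(`Motives.AlgPoints.isProperMap_map`) and surjective, and the algebraic descent datum has been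
made effective (SGA 1 IX 4.7).

#harness_tags topology.proper_maps, topology.descent
-/

open Set Function Topology

namespace Literature.Topology

universe u v w x

variable {E : Type u} {T : Type v} {B : Type w} {B' : Type x} [TopologicalSpace E]
  [TopologicalSpace T] [TopologicalSpace B] [TopologicalSpace B'] (π : E → B) (τ : T → B)
  (p : B' → B)

/-- **Pull-backs of proper maps are proper**: for `p : B' → B` proper and `π : E → B` continuous,
the projection `E ×_B B' = {(e, b') | π e = p b'} → E` is proper (closed by universal
closedness of `p`, with fibres the compact fibres of `p`). [folklore] -/
theorem isProperMap_pullback_fst (hπ : Continuous π) (hp : IsProperMap p) :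
    IsProperMap (fun q : {q : E × B' // π q.1 = p q.2} ↦ q.1.1) := by
  rw [isProperMap_iff_isClosedMap_and_compact_fibers]
  refine ⟨by fun_prop, fun C hC ↦ ?_, fun e ↦ ?_⟩
  · -- `C = F ∩ C''` with `C''` closed in `E × B'`; the image is `{e | (e, π e) ∈ (id × p) C''}`
    obtain ⟨C'', hC'', rfl⟩ := isClosed_induced_iff.mp hC
    have hcl : IsClosed ((Prod.map id p) '' C'') := (isProperMap_id.prodMap hp).isClosedMap _ hC''
    have heq : (fun q : {q : E × B' // π q.1 = p q.2} ↦ q.1.1) '' (Subtype.val ⁻¹' C'') =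
        (fun e ↦ (e, π e)) ⁻¹' ((Prod.map id p) '' C'') := by
      ext e
      constructor
      · rintro ⟨⟨⟨e', b⟩, hq⟩, hC, rfl⟩
        exact ⟨(e', b), hC, Prod.ext rfl hq.symm⟩
      · rintro ⟨⟨e', b⟩, hC, hx⟩
        have h1 : e' = e := congrArg Prod.fst hx
        have h2 : p b = π e := congrArg Prod.snd hx
        subst h1
        exact ⟨⟨(e', b), h2.symm⟩, hC, rfl⟩
    rw [heq]
    exact hcl.preimage (by fun_prop)
  · -- the fibre over `e` is the image of the compact fibre `p⁻¹ {π e}`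
    have hK : IsCompact (p ⁻¹' {π e}) := hp.isCompact_preimage isCompact_singleton
    let ι : p ⁻¹' {π e} → {q : E × B' // π q.1 = p q.2} := fun b ↦ ⟨(e, b.1), by
      have := b.2
      rw [mem_preimage, mem_singleton_iff] at this
      exact this.symm⟩
    have hι : Continuous ι := by fun_prop
    have hrange : (fun q : {q : E × B' // π q.1 = p q.2} ↦ q.1.1) ⁻¹' {e} = range ι := by
      ext ⟨⟨e', b⟩, hq⟩
      simp only [mem_preimage, mem_singleton_iff, mem_range, ι, Subtype.mk.injEq, Prod.mk.injEq]
      constructor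
      · rintro rfl
        exact ⟨⟨b, by rw [mem_preimage, mem_singleton_iff]; exact hq.symm⟩, rfl, rfl⟩
      · rintro ⟨b', rfl, rfl⟩
        rfl
    rw [hrange]
    haveI : CompactSpace (p ⁻¹' {π e}) := isCompact_iff_compactSpace.mp hK
    exact isCompact_range hι

omit [TopologicalSpace E] [TopologicalSpace B] [TopologicalSpace B'] in
/-- The projection `E ×_B B' → E` is surjective when `p` is. [folklore] -/
theorem surjective_pullback_fst (hp : Surjective p) :
    Surjective (fun q : {q : E × B' // π q.1 = p q.2} ↦ q.1.1) := fun e ↦ by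
  obtain ⟨b, hb⟩ := hp (π e)
  exact ⟨⟨(e, b), hb.symm⟩, rfl⟩

/-- **Pull-backs of proper surjections are quotient maps**: for `p : B' → B` proper surjective
and `π : E → B` continuous, `E ×_B B' → E` is a (closed, surjective, hence) quotient map.
[folklore] -/
theorem isQuotientMap_pullback_fst (hπ : Continuous π) (hp : IsProperMap p) (hps : Surjective p) :
    IsQuotientMap (fun q : {q : E × B' // π q.1 = p q.2} ↦ q.1.1) :=
  (isProperMap_pullback_fst π p hπ hp).isClosedMap.isQuotientMap (by fun_prop)
    (surjective_pullback_fst π p hps)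

omit [TopologicalSpace E] [TopologicalSpace T] [TopologicalSpace B] [TopologicalSpace B'] in
/-- **Descent of maps along surjections (set-theoretic part).** For `p : B' → B` surjective and a
map `φ' : E ×_B B' → T` constant on the fibres of `E ×_B B' → E` (i.e. compatible with the
canonical descent datum), `φ'` factors uniquely through a map `φ : E → T`; by
`continuous_of_comp_pullback_fst` the factorisation is continuous when `φ'` is and `p` is
proper. [folklore] -/
theorem existsUnique_factor (hps : Surjective p) (φ' : {q : E × B' // π q.1 = p q.2} → T)
    (hcompat : ∀ q q' : {q : E × B' // π q.1 = p q.2}, q.1.1 = q'.1.1 → φ' q = φ' q') :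
    ∃! φ : E → T, ∀ q, φ q.1.1 = φ' q := by
  have hsurj := surjective_pullback_fst π p hps
  refine ⟨fun e ↦ φ' (Classical.choose (hsurj e)), fun q ↦ ?_, fun φ hφ ↦ ?_⟩
  · exact hcompat _ _ (Classical.choose_spec (hsurj q.1.1))
  · funext e
    obtain ⟨q, rfl⟩ := hsurj e
    rw [hφ q]
    exact hcompat _ _ (Classical.choose_spec (hsurj q.1.1)).symm

/-- **Descent of continuity along proper surjections**: a map `φ : E → T` whose composite with
the quotient map `E ×_B B' → E` is continuous is continuous. [folklore] -/
theorem continuous_of_comp_pullback_fst (hπ : Continuous π) (hp : IsProperMap p)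
    (hps : Surjective p) {φ : E → T}
    (hφ : Continuous fun q : {q : E × B' // π q.1 = p q.2} ↦ φ q.1.1) : Continuous φ :=
  (isQuotientMap_pullback_fst π p hπ hp hps).continuous_iff.mpr hφ

/-- **Descent of homeomorphisms along proper surjections.** Let `p : B' → B` be proper and
surjective, `π : E → B`, `τ : T → B` continuous, and `Ψ' : E ×_B B' ≃ₜ T ×_B B'` a homeomorphism
over `B'` whose `E`/`T`-components are constant on the fibres over `E`, resp. `T` (compatibility
with the canonical descent data, for `Ψ'` and its inverse). Then `Ψ'` descends to a homeomorphism
`Ψ : E ≃ₜ T` over `B` with `Ψ (pr q) = pr (Ψ' q)`. (Proper surjections are effective descent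
morphisms for spaces over `B`, on the level of morphisms.) [folklore] -/
theorem exists_homeomorph_descent (hπ : Continuous π) (hτ : Continuous τ) (hp : IsProperMap p)
    (hps : Surjective p)
    (Ψ' : {q : E × B' // π q.1 = p q.2} ≃ₜ {q : T × B' // τ q.1 = p q.2})
    (hΨ'B : ∀ q, (Ψ' q).1.2 = q.1.2)
    (hΨ' : ∀ q q' : {q : E × B' // π q.1 = p q.2}, q.1.1 = q'.1.1 → (Ψ' q).1.1 = (Ψ' q').1.1)
    (hΨ's : ∀ r r' : {q : T × B' // τ q.1 = p q.2}, r.1.1 = r'.1.1 →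
      (Ψ'.symm r).1.1 = (Ψ'.symm r').1.1) :
    ∃ Ψ : E ≃ₜ T, (∀ q, Ψ q.1.1 = (Ψ' q).1.1) ∧ ∀ e, τ (Ψ e) = π e := by
  obtain ⟨φ, hφ, -⟩ := existsUnique_factor π p hps (fun q ↦ (Ψ' q).1.1) hΨ'
  obtain ⟨ψ, hψ, -⟩ := existsUnique_factor τ p hps (fun r ↦ (Ψ'.symm r).1.1) hΨ's
  have hsurjE := surjective_pullback_fst π p hps
  have hsurjT := surjective_pullback_fst τ p hps
  have hφψ : ∀ t, φ (ψ t) = t := fun t ↦ by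
    obtain ⟨r, rfl⟩ := hsurjT t
    rw [hψ r]
    -- `Ψ'.symm r` lies over `ψ t`, so `φ (ψ t) = (Ψ' (Ψ'.symm r)).1.1 = t`
    have := hφ (Ψ'.symm r)
    rw [Homeomorph.apply_symm_apply] at this
    exact this
  have hψφ : ∀ e, ψ (φ e) = e := fun e ↦ by
    obtain ⟨q, rfl⟩ := hsurjE e
    rw [hφ q]
    have := hψ (Ψ' q)
    rw [Homeomorph.symm_apply_apply] at this
    exact this
  have hφc : Continuous φ :=
    continuous_of_comp_pullback_fst π p hπ hp hps (by simpa only [hφ] using (by fun_prop :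
      Continuous fun q : {q : E × B' // π q.1 = p q.2} ↦ (Ψ' q).1.1))
  have hψc : Continuous ψ :=
    continuous_of_comp_pullback_fst τ p hτ hp hps (by simpa only [hψ] using (by fun_prop :
      Continuous fun r : {q : T × B' // τ q.1 = p q.2} ↦ (Ψ'.symm r).1.1))
  let Ψ : E ≃ₜ T :=
    { toFun := φ
      invFun := ψ
      left_inv := hψφ
      right_inv := hφψ
      continuous_toFun := hφc
      continuous_invFun := hψc }
  refine ⟨Ψ, hφ, fun e ↦ ?_⟩
  obtain ⟨q, rfl⟩ := hsurjE e
  change τ (φ q.1.1) = π q.1.1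
  rw [hφ q, (Ψ' q).2, hΨ'B q]
  exact q.2.symm

end Literature.Topology
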